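import Literature.AlgebraicGeometry.Motives.AbelianVarietyEndGaloisFinite
import Literature.NumberTheory.DiophantineGeometry.AVIsogenyTateHoldsProofs
import HarnessLib

/-!
# A homomorphism of abelian varieties is determined by its values on the torsion points
# (Milne 1986, Lemma 12.6 + Mumford §19 Thm. 3: `Hom(A, B)` is a free `ℤ`-module)

Topic `Literature/AlgebraicGeometry/Motives`, namespace `Literature.AlgebraicGeometry.Motives.AbelianVariety`.
PROOF-ONLY file (no definition, no named fact; net Literature debt 0).

For abelian varieties `A, B` over a field `K` of characteristic `0`:

* `hom_eq_zero_of_forall_torsionPoints` (`K` algebraically closed) — a homomorphism `φ : A → B`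
  killing every torsion point of `A(K)` (`φ(Q) = 0` for all `Q ∈ A[n](K)`, all `n ≥ 1`) is `0`;
  `hom_eq_of_forall_torsionPoints` — two homomorphisms agreeing on all torsion points of `A(K)` are
  equal; `_geom` versions for an arbitrary `K` of characteristic `0` with the torsion points taken in
  `A(K̄)`.

Proof: by Milne's Lemma 12.6 (the tree's PROVED `exists_eq_zsmul_of_forall_torsionPoints_self` /
`exists_eq_zsmul_of_forall_torsionPoints`: a homomorphism killing `A[n]` is divisible by `n`, `n`
invertible in `K`) such a `φ` is divisible by EVERY `n ≥ 1` in `Hom(A, B)`, which is a free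
`ℤ`-module (Mumford §19 Thm. 3 with Cor. 1, the tree's `module_free_hom_holds`); an element of a free
`ℤ`-module divisible by every positive integer is `0` (each coordinate is an integer divisible by every
`n`).  This is the standard «torsion points are Zariski dense» rigidity (Mumford §19, proof of Thm. 3;
Milne Lemma 12.6 / proof of Thm. 12.5 «`T_ℓ` is faithful»), in the form consumers use: UNIQUENESS
of a homomorphism / isomorphism with prescribed values on the points of finite order — e.g. the
isomorphism `λ : A → A^σ` of Shimura's proof of Thm. 21.4 (p. 192: «`c` is uniquely determined by
`σ` … this shows that `λ` … depends only on `σ`», the points of finite order being `r(K/𝔞)`).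

## References

* [Milne1986AbelianVarieties] J. S. Milne, *Abelian Varieties* (in Cornell–Silverman, *Arithmetic
  Geometry*, 1986), §12 Lemma 12.6, Thm. 12.5.
* [MumfordAV1970] D. Mumford, *Abelian Varieties* (1970), §19 Thm. 3 and Cor. 1.
* [Shimura1998] G. Shimura, *Abelian Varieties with Complex Multiplication and Modular Functions*
  (1998), §21.4, proof of Thm. 21.4, p. 192.
-/

noncomputable section

open CategoryTheory
open scoped MonObj

universe u

namespace Literature.AlgebraicGeometry.Motives.AbelianVariety

/-! ### Algebra: an infinitely divisible element of a free `ℤ`-module is zero -/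

/-- In a free `ℤ`-module an element divisible by every positive integer is `0` (every coordinate in a
basis is an integer divisible by every `n ≥ 1`). [folklore] -/
private theorem eq_zero_of_forall_exists_nsmul_eq {M : Type*} [AddCommGroup M] [Module.Free ℤ M]
    {x : M} (h : ∀ n : ℕ, 0 < n → ∃ y : M, x = n • y) : x = 0 := by
  classical
  let b := Module.Free.chooseBasis ℤ M
  by_contra hx
  -- a non-zero coordinate `c = b.repr x i`
  obtain ⟨i, hi⟩ : ∃ i, b.repr x i ≠ 0 := by
    by_contra h'
    push Not at h'
    exact hx (b.repr.injective (by ext i; rw [h' i, map_zero, Finsupp.zero_apply]))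
  -- `x = (|c| + 1) • y` forces `|c| ≥ |c| + 1`
  obtain ⟨y, hy⟩ := h ((b.repr x i).natAbs + 1) (Nat.succ_pos _)
  have hc : b.repr x i = (((b.repr x i).natAbs + 1 : ℕ) : ℤ) * b.repr y i := by
    conv_lhs => rw [hy]
    rw [map_nsmul, Finsupp.smul_apply, nsmul_eq_mul]
  rcases eq_or_ne (b.repr y i) 0 with h0 | h0
  · exact hi (by rw [hc, h0, mul_zero])
  · have h1 : 1 ≤ |b.repr y i| := Int.one_le_abs h0
    have habs : |b.repr x i| = (((b.repr x i).natAbs + 1 : ℕ) : ℤ) * |b.repr y i| := by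
      conv_lhs => rw [hc]
      rw [abs_mul, Nat.abs_cast]
    have hnat : (((b.repr x i).natAbs : ℕ) : ℤ) = |b.repr x i| := Int.natCast_natAbs _
    push_cast at habs
    nlinarith

/-! ### Over an algebraically closed field: torsion points of `A(K)` -/

section AlgClosed

variable {K : Type u} [Field K] [IsAlgClosed K] [CharZero K] {A B : AbelianVariety K}

/-- **A homomorphism killing all torsion points is zero** (`K` algebraically closed of characteristic
`0`): if `φ : A → B` satisfies `φ(Q) = 0` for every `Q ∈ A[n](K)` and every `n ≥ 1`, then `φ = 0` —
`φ` is divisible by every `n` (Milne Lemma 12.6, `exists_eq_zsmul_of_forall_torsionPoints_self`) in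
the free `ℤ`-module `Hom(A, B)` (Mumford §19 Thm. 3, `module_free_hom_holds`).
[cite: Milne1986AbelianVarieties, §12 Lemma 12.6 (PDF p. 191)] [cite: MumfordAV1970, §19 Thm. 3 and Cor. 1] -/
theorem hom_eq_zero_of_forall_torsionPoints (φ : A ⟶ B)
    (hφ : ∀ n : ℕ, 0 < n → ∀ Q ∈ A.torsionPoints K n,
      (Q ≫ φ.hom.hom.hom : Literature.AlgebraicGeometry.Motives.specOver K K ⟶ B.X) = 1) :
    φ = 0 := by
  haveI : Module.Free ℤ (A ⟶ B) := module_free_hom_holds A B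
  refine eq_zero_of_forall_exists_nsmul_eq fun n hn => ?_
  have hnK : ((n : ℤ) : K) ≠ 0 := by
    rw [Int.cast_natCast]
    exact Nat.cast_ne_zero.2 hn.ne'
  obtain ⟨χ, hχ⟩ := exists_eq_zsmul_of_forall_torsionPoints_self (n : ℤ) hnK φ (hφ n hn)
  exact ⟨χ, by rw [hχ, natCast_zsmul]⟩

/-- **Two homomorphisms of abelian varieties agreeing on all torsion points are equal** (`K`
algebraically closed of characteristic `0`): if `f(Q) = g(Q)` for every `Q ∈ A[n](K)`, `n ≥ 1`, then
`f = g` (apply `hom_eq_zero_of_forall_torsionPoints` to `f - g`, which acts on points by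
`Q ↦ f(Q) g(Q)⁻¹`).  Uniqueness clause behind Shimura's «`λ` depends only on `σ`» (p. 192).
[cite: Milne1986AbelianVarieties, §12 Lemma 12.6 (PDF p. 191)] [cite: MumfordAV1970, §19 Thm. 3 and Cor. 1] -/
theorem hom_eq_of_forall_torsionPoints (f g : A ⟶ B)
    (h : ∀ n : ℕ, 0 < n → ∀ Q ∈ A.torsionPoints K n,
      (Q ≫ f.hom.hom.hom : Literature.AlgebraicGeometry.Motives.specOver K K ⟶ B.X) = Q ≫ g.hom.hom.hom) :
    f = g := by
  rw [← sub_eq_zero]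
  refine hom_eq_zero_of_forall_torsionPoints (f - g) fun n hn Q hQ => ?_
  change Q ≫ (f.hom / g.hom).hom.hom = 1
  rw [Grp.Hom.hom_hom_div, GrpObj.comp_div, h n hn Q hQ, div_self']

/-- The same with the points map written `AlgPoints.map` (`AlgPoints.map φ Q = Q ≫ φ`): two
homomorphisms with `AlgPoints.map f Q = AlgPoints.map g Q` on all torsion points `Q` of `A(K)` are
equal. [cite: Milne1986AbelianVarieties, §12 Lemma 12.6 (PDF p. 191)] [cite: MumfordAV1970, §19 Thm. 3 and Cor. 1] -/
theorem hom_eq_of_forall_torsionPoints_map (f g : A ⟶ B)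
    (h : ∀ n : ℕ, 0 < n → ∀ Q ∈ A.torsionPoints K n,
      AlgPoints.map f.hom.hom.hom Q = AlgPoints.map g.hom.hom.hom Q) :
    f = g :=
  hom_eq_of_forall_torsionPoints f g h

/-- **An isomorphism of abelian varieties is determined by its values on the torsion points**: two
isomorphisms `e e' : A ≅ B` with `e(Q) = e'(Q)` on all torsion points of `A(K)` are equal.
[cite: Milne1986AbelianVarieties, §12 Lemma 12.6 (PDF p. 191)] [cite: MumfordAV1970, §19 Thm. 3 and Cor. 1] -/
theorem iso_ext_of_forall_torsionPoints (e e' : A ≅ B)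
    (h : ∀ n : ℕ, 0 < n → ∀ Q ∈ A.torsionPoints K n,
      AlgPoints.map e.hom.hom.hom.hom Q = AlgPoints.map e'.hom.hom.hom.hom Q) :
    e = e' :=
  Iso.ext (hom_eq_of_forall_torsionPoints e.hom e'.hom h)

end AlgClosed

/-! ### Over any field of characteristic `0`: torsion points of `A(K̄)` -/

section Geom

variable {K : Type u} [Field K] [CharZero K] {A B : AbelianVariety K}

/-- **A homomorphism killing all geometric torsion points is zero** (`K` of characteristic `0`,
torsion points in `A(K̄)`): Milne Lemma 12.6 (`exists_eq_zsmul_of_forall_torsionPoints`) for every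
`n ≥ 1`, and freeness of `Hom(A, B)`.
[cite: Milne1986AbelianVarieties, §12 Lemma 12.6 (PDF p. 191)] [cite: MumfordAV1970, §19 Thm. 3 and Cor. 1] -/
theorem hom_eq_zero_of_forall_torsionPoints_geom (φ : A ⟶ B)
    (hφ : ∀ n : ℕ, 0 < n → ∀ Q ∈ A.torsionPoints (AlgebraicClosure K) n,
      (Q ≫ φ.hom.hom.hom :
        Literature.AlgebraicGeometry.Motives.specOver K (AlgebraicClosure K) ⟶ B.X) = 1) :
    φ = 0 := by
  haveI : Module.Free ℤ (A ⟶ B) := module_free_hom_holds A B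
  refine eq_zero_of_forall_exists_nsmul_eq fun n hn => ?_
  have hnK : ((n : ℤ) : K) ≠ 0 := by
    rw [Int.cast_natCast]
    exact Nat.cast_ne_zero.2 hn.ne'
  obtain ⟨χ, hχ⟩ := exists_eq_zsmul_of_forall_torsionPoints (n : ℤ) hnK φ (hφ n hn)
  exact ⟨χ, by rw [hχ, natCast_zsmul]⟩

/-- **Two homomorphisms agreeing on all geometric torsion points are equal** (`K` of characteristic
`0`, torsion points in `A(K̄)`). [cite: Milne1986AbelianVarieties, §12 Lemma 12.6 (PDF p. 191)] [cite: MumfordAV1970, §19 Thm. 3 and Cor. 1] -/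
theorem hom_eq_of_forall_torsionPoints_geom (f g : A ⟶ B)
    (h : ∀ n : ℕ, 0 < n → ∀ Q ∈ A.torsionPoints (AlgebraicClosure K) n,
      (Q ≫ f.hom.hom.hom :
        Literature.AlgebraicGeometry.Motives.specOver K (AlgebraicClosure K) ⟶ B.X) = Q ≫ g.hom.hom.hom) :
    f = g := by
  rw [← sub_eq_zero]
  refine hom_eq_zero_of_forall_torsionPoints_geom (f - g) fun n hn Q hQ => ?_
  change Q ≫ (f.hom / g.hom).hom.hom = 1
  rw [Grp.Hom.hom_hom_div, GrpObj.comp_div, h n hn Q hQ, div_self']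

end Geom

end Literature.AlgebraicGeometry.Motives.AbelianVariety

end
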